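import Mathlib.MeasureTheory.Integral.Bochner.Basic
import Mathlib.MeasureTheory.Integral.Bochner.Set
import Mathlib.MeasureTheory.Function.L1Space.Integrable
import Mathlib.Probability.Notation
import HarnessLib

/-!
# Stub `stub_truncatedFatou` of line `Sketch` (crux `stmt-QuantumFields-8760`)

Route `EquipartitionCriticality` of `YangMills`, crux item `stmt-QuantumFields-8760`
(`Summit.QuantumFields.YangMills.Theses.EquipartitionCriticality.EquipartitionPinsProbe`), line
`Sketch`, stub `stub_truncatedFatou` (TF, the abstract truncated Fatou lemma behind the
second-moment budget T2).

What is proved: on a sequence of probability spaces `(Ω, μ k)`, let `Y t k, Z t k : Ω → ℝ`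
(`t` in a finite index type `T`) be measurable with `Y t k − Z t k → 0` in probability for every
`t`, and suppose that eventually all `Z t k` are square integrable with `∑ t, ∫ (Z t k)² ∂μ k ≤ B`.
Then for every truncation level `M > 0` and every `η > 0`, eventually
`∑ t, ∫ min ((Y t k)², M) ∂μ k ≤ (1 + η) B + η`.

Proof: pointwise, for reals `y z` and `δ`, `min (y², M) ≤ (1+η) z² + M·𝟙{δ < |y−z|} + (1+η⁻¹) δ²`
(from `y² ≤ (1+η) z² + (1+η⁻¹)(y−z)²`, i.e. `0 ≤ (η z − (y−z))² / η`, on `{|y−z| ≤ δ}`, and from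
`min (y², M) ≤ M` on the complement). Integrating over the probability measure `μ k` gives
`∫ min (Y², M) ≤ (1+η) ∫ Z² + M·(μ k).real {δ < |Y−Z|} + (1+η⁻¹) δ²`; summing over `t`, choosing
`δ > 0` with `card T · (1+η⁻¹) δ² < η/2` and then `k` large so that
`M · ∑ t, (μ k).real {δ < |Y t k − Z t k|} < η/2` (finitely many sequences tending to `0`)
yields the claim.
-/

noncomputable section

open MeasureTheory Filter Topology

namespace Summit.QuantumFields.YangMills.Theorems.EquipartitionPinsProbe

namespace TangentTruncatedFatou

/-- The weighted parallelogram bound `y² ≤ (1+η) z² + (1+η⁻¹) (y−z)²` for `η > 0`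
(equivalently `0 ≤ η⁻¹ (η z − (y − z))²`). -/
theorem sq_le_weighted (y z : ℝ) {η : ℝ} (hη : 0 < η) :
    y ^ 2 ≤ (1 + η) * z ^ 2 + (1 + η⁻¹) * (y - z) ^ 2 := by
  have hη' : η ≠ 0 := hη.ne'
  have h : (1 + η) * z ^ 2 + (1 + η⁻¹) * (y - z) ^ 2 - y ^ 2 = η⁻¹ * (η * z - (y - z)) ^ 2 := by
    field_simp
    ring
  have h' : 0 ≤ η⁻¹ * (η * z - (y - z)) ^ 2 := by positivity
  linarith

/-- Pointwise truncated bound: for `η > 0` and any `M`, `δ`,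
`min (Y², M) ≤ (1+η) Z² + M·𝟙{δ < |Y − Z|} + (1+η⁻¹) δ²` at every point. -/
theorem min_sq_le_pointwise {Ω : Type*} (Y Z : Ω → ℝ) {M η : ℝ} (δ : ℝ) (hη : 0 < η) (ω : Ω) :
    min (Y ω ^ 2) M ≤ (1 + η) * Z ω ^ 2 + {ω | δ < |Y ω - Z ω|}.indicator (fun _ => M) ω +
      (1 + η⁻¹) * δ ^ 2 := by
  have h1 := sq_le_weighted (Y ω) (Z ω) hη
  have h2 : 0 ≤ (1 + η) * Z ω ^ 2 := by positivity
  have h3 : (0 : ℝ) ≤ 1 + η⁻¹ := by positivity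
  by_cases h : δ < |Y ω - Z ω|
  · rw [Set.indicator_of_mem (show ω ∈ {ω | δ < |Y ω - Z ω|} from h)]
    have h4 := min_le_right (Y ω ^ 2) M
    nlinarith [sq_nonneg δ]
  · rw [Set.indicator_of_notMem (show ω ∉ {ω | δ < |Y ω - Z ω|} from h), add_zero]
    have h4 : (Y ω - Z ω) ^ 2 ≤ δ ^ 2 := by
      rw [← sq_abs (Y ω - Z ω)]
      exact pow_le_pow_left₀ (abs_nonneg _) (le_of_not_gt h) 2
    have h5 := min_le_left (Y ω ^ 2) M
    nlinarith [mul_le_mul_of_nonneg_left h4 h3]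

/-- Integrated truncated bound on a probability space: for measurable `Y Z` with `Z²` integrable,
`M ≥ 0`, `η > 0` and any `δ`,
`∫ min (Y², M) ≤ (1+η) ∫ Z² + M · μ.real {δ < |Y − Z|} + (1+η⁻¹) δ²`. -/
theorem integral_min_sq_le {Ω : Type*} [MeasurableSpace Ω] {μ : Measure Ω} [IsProbabilityMeasure μ]
    {Y Z : Ω → ℝ} (hY : Measurable Y) (hZ : Measurable Z) (hZi : Integrable (fun ω => Z ω ^ 2) μ)
    {M η : ℝ} (δ : ℝ) (hM : 0 ≤ M) (hη : 0 < η) :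
    ∫ ω, min (Y ω ^ 2) M ∂μ ≤
      (1 + η) * ∫ ω, Z ω ^ 2 ∂μ + M * μ.real {ω | δ < |Y ω - Z ω|} + (1 + η⁻¹) * δ ^ 2 := by
  have hm : Measurable fun ω => |Y ω - Z ω| := continuous_abs.measurable.comp (hY.sub hZ)
  have hs : MeasurableSet {ω | δ < |Y ω - Z ω|} := measurableSet_lt measurable_const hm
  have h1 : Integrable (fun ω => (1 + η) * Z ω ^ 2) μ := hZi.const_mul _
  have h2 : Integrable (fun ω => (1 + η) * Z ω ^ 2 + {ω | δ < |Y ω - Z ω|}.indicator (fun _ => M) ω)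
      μ := h1.add ((integrable_const M).indicator hs)
  have h3 : Integrable (fun ω => (1 + η) * Z ω ^ 2 +
      {ω | δ < |Y ω - Z ω|}.indicator (fun _ => M) ω + (1 + η⁻¹) * δ ^ 2) μ :=
    h2.add (integrable_const _)
  calc ∫ ω, min (Y ω ^ 2) M ∂μ
      ≤ ∫ ω, ((1 + η) * Z ω ^ 2 + {ω | δ < |Y ω - Z ω|}.indicator (fun _ => M) ω +
          (1 + η⁻¹) * δ ^ 2) ∂μ :=
        integral_mono_of_nonneg (Eventually.of_forall fun ω => le_min (sq_nonneg _) hM) h3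
          (Eventually.of_forall fun ω => min_sq_le_pointwise Y Z δ hη ω)
    _ = (1 + η) * ∫ ω, Z ω ^ 2 ∂μ + M * μ.real {ω | δ < |Y ω - Z ω|} + (1 + η⁻¹) * δ ^ 2 := by
        rw [integral_add h2 (integrable_const _), integral_add h1 ((integrable_const M).indicator hs),
          integral_const_mul, integral_indicator_const _ hs, integral_const, probReal_univ,
          smul_eq_mul, smul_eq_mul, one_mul, mul_comm (μ.real _) M]

end TangentTruncatedFatou

/-- STUB `stub_truncatedFatou` (TF) — **abstract truncated Fatou lemma**: on probability spaces
`(Ω, μ k)`, if `Y t k − Z t k → 0` in probability for each `t` of a finite type `T` and eventually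
`∑ t, ∫ (Z t k)² ∂μ k ≤ B` (with all `Z t k` square integrable), then for all `M > 0`, `η > 0`,
eventually `∑ t, ∫ min ((Y t k)², M) ∂μ k ≤ (1 + η) B + η`. -/
theorem stub_truncatedFatou :
    ∀ (Ω : Type) [MeasurableSpace Ω] (T : Type) [Fintype T] (μ : ℕ → MeasureTheory.Measure Ω),
      (∀ k, MeasureTheory.IsProbabilityMeasure (μ k)) →
      ∀ (Y Z : T → ℕ → Ω → ℝ), (∀ t k, Measurable (Y t k)) → (∀ t k, Measurable (Z t k)) →
        (∀ (t : T) (δ : ℝ), 0 < δ →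
          Filter.Tendsto (fun k : ℕ => (μ k).real {ω | δ < |Y t k ω - Z t k ω|}) Filter.atTop (nhds 0)) →
        ∀ B : ℝ, (∀ᶠ k : ℕ in Filter.atTop,
          (∀ t, MeasureTheory.Integrable (fun ω => (Z t k ω) ^ 2) (μ k)) ∧
            ∑ t, ∫ ω, (Z t k ω) ^ 2 ∂(μ k) ≤ B) →
        ∀ (M η : ℝ), 0 < M → 0 < η → ∀ᶠ k : ℕ in Filter.atTop,
          ∑ t, ∫ ω, min ((Y t k ω) ^ 2) M ∂(μ k) ≤ (1 + η) * B + η := by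
  intro Ω _ T _ μ hμ Y Z hY hZ hP B hB M η hM hη
  -- choose `δ > 0` with `card T · (1+η⁻¹) δ² < η/2`
  obtain ⟨δ, hδ0, hδ⟩ : ∃ δ : ℝ, 0 < δ ∧ (Fintype.card T : ℝ) * ((1 + η⁻¹) * δ ^ 2) < η / 2 := by
    have h1 : Tendsto (fun δ : ℝ => (Fintype.card T : ℝ) * ((1 + η⁻¹) * δ ^ 2)) (𝓝 0) (𝓝 0) := by
      have hc : Continuous fun δ : ℝ => (Fintype.card T : ℝ) * ((1 + η⁻¹) * δ ^ 2) := by fun_prop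
      simpa using hc.tendsto 0
    have h2 : ∀ᶠ δ in 𝓝[>] (0 : ℝ),
        (Fintype.card T : ℝ) * ((1 + η⁻¹) * δ ^ 2) < η / 2 ∧ δ ∈ Set.Ioi (0 : ℝ) :=
      ((h1.mono_left nhdsWithin_le_nhds).eventually_lt_const (half_pos hη)).and self_mem_nhdsWithin
    obtain ⟨δ, hδ, hδ0⟩ := h2.exists
    exact ⟨δ, hδ0, hδ⟩
  -- for `k` large, `M · ∑ t, (μ k).real {δ < |Y t k − Z t k|} < η/2`
  have h3 : ∀ᶠ k : ℕ in atTop, M * ∑ t, (μ k).real {ω | δ < |Y t k ω - Z t k ω|} < η / 2 := by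
    have h4 : Tendsto (fun k : ℕ => M * ∑ t, (μ k).real {ω | δ < |Y t k ω - Z t k ω|}) atTop
        (𝓝 (M * ∑ _t : T, (0 : ℝ))) :=
      (tendsto_finsetSum Finset.univ fun t _ => hP t δ hδ0).const_mul M
    rw [Finset.sum_const_zero, mul_zero] at h4
    exact h4.eventually_lt_const (half_pos hη)
  filter_upwards [hB, h3] with k hBk h3k
  obtain ⟨hint, hsum⟩ := hBk
  haveI : IsProbabilityMeasure (μ k) := hμ k
  have key : ∀ t, ∫ ω, min (Y t k ω ^ 2) M ∂μ k ≤
      (1 + η) * ∫ ω, Z t k ω ^ 2 ∂μ k + M * (μ k).real {ω | δ < |Y t k ω - Z t k ω|} +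
        (1 + η⁻¹) * δ ^ 2 :=
    fun t => TangentTruncatedFatou.integral_min_sq_le (hY t k) (hZ t k) (hint t) δ hM.le hη
  calc ∑ t, ∫ ω, min (Y t k ω ^ 2) M ∂μ k
      ≤ ∑ t, ((1 + η) * ∫ ω, Z t k ω ^ 2 ∂μ k + M * (μ k).real {ω | δ < |Y t k ω - Z t k ω|} +
          (1 + η⁻¹) * δ ^ 2) := Finset.sum_le_sum fun t _ => key t
    _ = (1 + η) * ∑ t, ∫ ω, Z t k ω ^ 2 ∂μ k +
          M * ∑ t, (μ k).real {ω | δ < |Y t k ω - Z t k ω|} +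
          Fintype.card T * ((1 + η⁻¹) * δ ^ 2) := by
        rw [Finset.sum_add_distrib, Finset.sum_add_distrib, Finset.mul_sum, Finset.mul_sum,
          Finset.sum_const, Finset.card_univ, nsmul_eq_mul]
    _ ≤ (1 + η) * B + η := by
        have h5 : (1 + η) * ∑ t, ∫ ω, Z t k ω ^ 2 ∂μ k ≤ (1 + η) * B :=
          mul_le_mul_of_nonneg_left hsum (by positivity)
        linarith

end Summit.QuantumFields.YangMills.Theorems.EquipartitionPinsProbe

end
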